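import Summits.AtomisticToContinuum.HydrodynamicLimit.Theorems.AntiMazurCoboundariesCellForecastPressureDecayEnskogObjectsB
import Summits.AtomisticToContinuum.HydrodynamicLimit.Theorems.AntiMazurCoboundariesCellForecastPressureDecayContactLayerBoundsA
import Summits.AtomisticToContinuum.HydrodynamicLimit.Theorems.AntiMazurCoboundariesCellForecastPressureDecayContactStatisticsReduction
import Literature.MathematicalPhysics.KineticTheory.HardSphereEulerProofs
import HarnessLib

/-!
# S2e(C) · the short-time cluster tail, piece 3: the insertion (particle-removal) inequality for the cell law
# (registered sub-goal `stub_clusterTail_insertion` of stub `stub_clusterTail`, crux line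
# `enskog-compensator-martingale`, crux `CellForecastPressureDecay`, stmt-AtomisticToContinuum-13915)

The measure-theoretic input of the particle-removal charging of `ClusterTail σ` (S2e): under the canonical cell
law `P_{m+1,L}` the spheres other than a tagged one are distributed, up to the factor `Ξ_m/Ξ_{m+1} ≤ 2` (Ruelle's
insertion bound at packing fraction `≤ (8π/3)σ³ ≤ 1/2`, `hcProb_univ_sdiff_le_two_pow_mul` of piece S2b(A)), like
`P_{m,L}`, the tagged sphere being uniform on the cube with an independent Maxwellian velocity:
`∫ F dP_{m+1,L} ≤ 2 ∫dγ(w) ∫dP_{m,L}(z') ∫dν(y) F(insert_j (y,w) z')` (`lintegral_cellLaw_succ_le`; position form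
`lintegral_posLaw_succ_le` via `Fin.insertNth`/`MeasureTheory.measurePreserving_piFinSuccAbove` and
`CellLawFactorises`). Consequences: almost every datum restricts to a good datum of the flow with one sphere less
(`ae_removeNth_mem_good`), and the mean kinetic energy is `≤ 3n` (`lintegral_kinetic_cellLaw_le`).

References: D. Ruelle, *Statistical Mechanics: Rigorous Results* (1969), §4.2; H.-O. Georgii, *Gibbs Measures and
Phase Transitions*, 2nd ed. (2011), §1.2 (GNZ/insertion identities for hard cores, in finite volume: Tonelli).
-/

noncomputable section

open MeasureTheory ProbabilityTheory Set Filter Topology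
open scoped ENNReal BigOperators InnerProductSpace
open Literature.Analysis.FluidPDE Literature.MathematicalPhysics.KineticTheory
open Literature.MathematicalPhysics.StatisticalMechanics
open Summit.AtomisticToContinuum.HydrodynamicLimit.Theorems.CellForecastPressureDecay
  (cellCube measurableSet_cellCube volume_cellCube)

namespace Summit.AtomisticToContinuum.HydrodynamicLimit.Theorems.EnskogCompensator

/-! ## Inserting a point into a hard-core configuration -/

section Insert

variable {X : Type*}

/-- `Fin.insertNth j y x'` satisfies the hard core of the labels `≠ j` iff `x'` satisfies its hard core. [folklore] -/
theorem insertNth_mem_hardCoreSet_iff (O : X → X → Prop) {m : ℕ} (j : Fin (m + 1)) (y : X) (x' : Fin m → X) :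
    (Fin.insertNth j y x' : Fin (m + 1) → X) ∈ hardCoreSet O ((Finset.univ : Finset (Fin (m + 1))) \ {j}) ↔
      x' ∈ hardCoreSet O (Finset.univ : Finset (Fin m)) := by
  constructor
  · intro h a _ b _ hab
    have hja : j.succAbove a ∈ (Finset.univ : Finset (Fin (m + 1))) \ {j} := by
      simp [Fin.succAbove_ne j a]
    have hjb : j.succAbove b ∈ (Finset.univ : Finset (Fin (m + 1))) \ {j} := by
      simp [Fin.succAbove_ne j b]
    have := h (j.succAbove a) hja (j.succAbove b) hjb (Fin.succAbove_right_injective.ne hab)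
    simpa [Fin.insertNth_apply_succAbove] using this
  · intro h i hi i' hi' hii'
    have hi0 : i ≠ j := by simpa using hi
    have hi0' : i' ≠ j := by simpa using hi'
    obtain ⟨a, rfl⟩ := Fin.exists_succAbove_eq hi0
    obtain ⟨b, rfl⟩ := Fin.exists_succAbove_eq hi0'
    have hab : a ≠ b := fun h' => hii' (h' ▸ rfl)
    simpa [Fin.insertNth_apply_succAbove] using h a (Finset.mem_univ a) b (Finset.mem_univ b) hab

end Insert

/-! ## The insertion inequality for the position law -/

section PosLaw

/-- **Integrating out the inserted point**: `∫ 1_{hc(univ∖{j})} G dν^{⊗(m+1)} = ∫_{hc_m} ∫ G(insert_j y x') dν(y) dν^{⊗m}(x')`.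
[folklore] -/
theorem lintegral_indicator_hardCore_sdiff_eq {L σ : ℝ} {m : ℕ} (j : Fin (m + 1))
    {G : (Fin (m + 1) → V3) → ℝ≥0∞} (hG : Measurable G) :
    ∫⁻ x, (hardCoreSet (fun y y' : V3 => ‖y - y'‖ < σ) ((Finset.univ : Finset (Fin (m + 1))) \ {j})).indicator G x
        ∂(Measure.pi fun _ : Fin (m + 1) => volume[|cellCube L]) =
      ∫⁻ x' in hardCoreSet (fun y y' : V3 => ‖y - y'‖ < σ) (Finset.univ : Finset (Fin m)),
        ∫⁻ y, G (Fin.insertNth j y x') ∂(volume[|cellCube L]) ∂(Measure.pi fun _ : Fin m => volume[|cellCube L]) := by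
  set ν : Measure V3 := volume[|cellCube L] with hν
  have hO := measurableSet_overlap_lt σ
  have hH1 : MeasurableSet (hardCoreSet (fun y y' : V3 => ‖y - y'‖ < σ)
      ((Finset.univ : Finset (Fin (m + 1))) \ {j}) : Set (Fin (m + 1) → V3)) := measurableSet_hardCoreSet hO _
  have hH0 : MeasurableSet (hardCoreSet (fun y y' : V3 => ‖y - y'‖ < σ)
      (Finset.univ : Finset (Fin m)) : Set (Fin m → V3)) := measurableSet_hardCoreSet hO _
  have hmp := measurePreserving_piFinSuccAbove (fun _ : Fin (m + 1) => ν) j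
  set e := MeasurableEquiv.piFinSuccAbove (fun _ : Fin (m + 1) => V3) j with he
  -- transport along the measurable equivalence `x ↦ (x j, x ∘ j.succAbove)`
  have h1 : ∫⁻ x, (hardCoreSet (fun y y' : V3 => ‖y - y'‖ < σ) ((Finset.univ : Finset (Fin (m + 1))) \ {j})).indicator G x
      ∂(Measure.pi fun _ : Fin (m + 1) => ν) =
      ∫⁻ p, (hardCoreSet (fun y y' : V3 => ‖y - y'‖ < σ) ((Finset.univ : Finset (Fin (m + 1))) \ {j})).indicator G
        (e.symm p) ∂(ν.prod (Measure.pi fun _ : Fin m => ν)) := by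
    rw [← hmp.map_eq, lintegral_map_equiv]
    simp only [he, MeasurableEquiv.symm_apply_apply]
  rw [h1]
  have hsymm : ∀ p : V3 × (Fin m → V3), e.symm p = Fin.insertNth j p.1 p.2 := fun p => rfl
  simp only [hsymm]
  have hind : ∀ p : V3 × (Fin m → V3),
      (hardCoreSet (fun y y' : V3 => ‖y - y'‖ < σ) ((Finset.univ : Finset (Fin (m + 1))) \ {j})).indicator G
        (Fin.insertNth j p.1 p.2) =
      (hardCoreSet (fun y y' : V3 => ‖y - y'‖ < σ) (Finset.univ : Finset (Fin m))).indicator 1 p.2 *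
        G (Fin.insertNth j p.1 p.2) := by
    intro p
    by_cases hp : p.2 ∈ hardCoreSet (fun y y' : V3 => ‖y - y'‖ < σ) (Finset.univ : Finset (Fin m))
    · rw [indicator_of_mem hp, indicator_of_mem ((insertNth_mem_hardCoreSet_iff _ j p.1 p.2).2 hp), Pi.one_apply,
        one_mul]
    · rw [indicator_of_notMem hp, indicator_of_notMem (fun h => hp ((insertNth_mem_hardCoreSet_iff _ j p.1 p.2).1 h)),
        zero_mul]
  simp only [hind]
  have hGm : Measurable fun p : V3 × (Fin m → V3) => G (Fin.insertNth j p.1 p.2) :=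
    hG.comp (e.symm.measurable)
  have hIm : Measurable fun p : V3 × (Fin m → V3) =>
      (hardCoreSet (fun y y' : V3 => ‖y - y'‖ < σ) (Finset.univ : Finset (Fin m))).indicator (1 : (Fin m → V3) → ℝ≥0∞) p.2 :=
    (measurable_one.indicator hH0).comp measurable_snd
  rw [lintegral_prod_symm (f := fun p : V3 × (Fin m → V3) =>
    (hardCoreSet (fun y y' : V3 => ‖y - y'‖ < σ) (Finset.univ : Finset (Fin m))).indicator (1 : (Fin m → V3) → ℝ≥0∞) p.2 *
      G (Fin.insertNth j p.1 p.2)) (hIm.mul hGm).aemeasurable]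
  rw [← lintegral_indicator hH0]
  refine lintegral_congr fun x' => ?_
  have hy : Measurable fun y : V3 => G (Fin.insertNth j y x') :=
    hGm.comp (measurable_id.prodMk measurable_const)
  dsimp only
  rw [lintegral_const_mul _ hy]
  by_cases hx : x' ∈ hardCoreSet (fun y y' : V3 => ‖y - y'‖ < σ) (Finset.univ : Finset (Fin m))
  · simp only [indicator_of_mem hx, Pi.one_apply, one_mul]
  · simp only [indicator_of_notMem hx, zero_mul]

/-- **The insertion inequality for the position law**: for `0 < σ ≤ 3/16`, `L ≥ 1`, `m ≤ 2L³` and measurable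
`F ≥ 0`, `∫ F dposLaw_{m+1} ≤ 2 ∫ dposLaw_m(x') ∫ F(insert_j y x') dν(y)`, `ν` the uniform law on the cube (the
inserted centre is uniform on the allowed region given the others; the ratio of partition functions is `≤ 2` by
Ruelle's insertion bound `Ξ(univ ∖ {j}) ≤ 2 Ξ(univ)`, `hcProb_univ_sdiff_le_two_pow_mul`). [cite: Ruelle1969, §4.2] -/
theorem lintegral_posLaw_succ_le {σ L : ℝ} (hσ : 0 < σ) (hσ' : σ ≤ 3 / 16) (hL : 1 ≤ L) {m : ℕ}
    (hm : (m : ℝ) ≤ 2 * L ^ 3) (j : Fin (m + 1)) {F : (Fin (m + 1) → V3) → ℝ≥0∞} (hF : Measurable F) :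
    ∫⁻ x, F x ∂posLaw σ L (m + 1) ≤
      2 * ∫⁻ x', ∫⁻ y, F (Fin.insertNth j y x') ∂(volume[|cellCube L]) ∂posLaw σ L m := by
  have hL0 : 0 < L := one_pos.trans_le hL
  set ν : Measure V3 := volume[|cellCube L] with hν
  haveI : IsProbabilityMeasure ν := isProbabilityMeasure_cond_cellCube hL0
  set O : V3 → V3 → Prop := fun y y' => ‖y - y'‖ < σ with hOdef
  have hO := measurableSet_overlap_lt σ
  have hOs : ∀ a b : V3, O a b → O b a := fun a b h => by simpa [hOdef, norm_sub_rev] using h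
  set π₁ : Measure (Fin (m + 1) → V3) := Measure.pi fun _ => ν with hπ₁
  set π₀ : Measure (Fin m → V3) := Measure.pi fun _ => ν with hπ₀
  set H₁ : Set (Fin (m + 1) → V3) := hardCoreSet O (Finset.univ : Finset (Fin (m + 1))) with hH₁
  set H₁' : Set (Fin (m + 1) → V3) := hardCoreSet O ((Finset.univ : Finset (Fin (m + 1))) \ {j}) with hH₁'
  set H₀ : Set (Fin m → V3) := hardCoreSet O (Finset.univ : Finset (Fin m)) with hH₀
  have hH1m : MeasurableSet H₁ := measurableSet_hardCoreSet hO _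
  have hH1m' : MeasurableSet H₁' := measurableSet_hardCoreSet hO _
  have hH0m : MeasurableSet H₀ := measurableSet_hardCoreSet hO _
  haveI : IsProbabilityMeasure π₁ := by rw [hπ₁]; infer_instance
  haveI : IsProbabilityMeasure π₀ := by rw [hπ₀]; infer_instance
  rw [posLaw_eq_cond_pi σ L (m + 1), posLaw_eq_cond_pi σ L m]
  change ∫⁻ x, F x ∂(π₁[|H₁]) ≤ 2 * ∫⁻ x', ∫⁻ y, F (Fin.insertNth j y x') ∂ν ∂(π₀[|H₀])
  -- the masses: `π₀ H₀ = π₁ H₁' ≤ 2 π₁ H₁`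
  have hmass : π₀ H₀ = π₁ H₁' := by
    have h := lintegral_indicator_hardCore_sdiff_eq (L := L) (σ := σ) j (G := 1) measurable_const
    rw [lintegral_indicator_one hH1m'] at h
    rw [h]
    simp only [Pi.one_apply, lintegral_const, measure_univ, mul_one, one_mul, Measure.restrict_apply_univ]
    rfl
  have hratio : π₁ H₁' ≤ 2 * π₁ H₁ := by
    have hp0 : 0 ≤ (L ^ 3)⁻¹ * (σ ^ 3 * (Real.pi * 4 / 3)) := by positivity
    have hnp : ((m + 1 : ℕ) : ℝ) * ((L ^ 3)⁻¹ * (σ ^ 3 * (Real.pi * 4 / 3))) ≤ 1 / 2 := by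
      have hnL : ((m + 1 : ℕ) : ℝ) * (L ^ 3)⁻¹ ≤ 3 := by
        rw [← div_eq_mul_inv, div_le_iff₀ (pow_pos hL0 3), Nat.cast_add, Nat.cast_one]
        have : (1 : ℝ) ≤ L ^ 3 := one_le_pow₀ hL
        linarith
      have hσ3 : σ ^ 3 ≤ (3 / 16) ^ 3 := pow_le_pow_left₀ hσ.le hσ' 3
      have hπ : Real.pi * 4 / 3 ≤ 16 / 3 := by linarith [Real.pi_le_four]
      calc ((m + 1 : ℕ) : ℝ) * ((L ^ 3)⁻¹ * (σ ^ 3 * (Real.pi * 4 / 3)))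
          = (((m + 1 : ℕ) : ℝ) * (L ^ 3)⁻¹) * σ ^ 3 * (Real.pi * 4 / 3) := by ring
        _ ≤ 3 * (3 / 16) ^ 3 * (16 / 3) := by gcongr
        _ ≤ 1 / 2 := by norm_num
    have h2 := hcProb_univ_sdiff_le_two_pow_mul ν hO hOs hp0 (fun z => cond_cellCube_ball_le hL0 hσ.le z) hnp {j}
    simp only [Finset.card_singleton, pow_one, hcProb] at h2
    have h3 : π₁.real H₁' ≤ 2 * π₁.real H₁ := h2
    calc π₁ H₁' = ENNReal.ofReal (π₁.real H₁') := (ofReal_measureReal (measure_ne_top _ _)).symm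
      _ ≤ ENNReal.ofReal (2 * π₁.real H₁) := ENNReal.ofReal_le_ofReal h3
      _ = 2 * π₁ H₁ := by
          rw [ENNReal.ofReal_mul zero_le_two, ENNReal.ofReal_ofNat, ofReal_measureReal (measure_ne_top _ _)]
  -- the numerator
  have hnum : ∫⁻ x in H₁, F x ∂π₁ ≤ π₀ H₀ * ∫⁻ x', ∫⁻ y, F (Fin.insertNth j y x') ∂ν ∂(π₀[|H₀]) := by
    have hsub : H₁ ⊆ H₁' := fun x hx a ha b hb hab => hx a (Finset.mem_univ a) b (Finset.mem_univ b) hab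
    calc ∫⁻ x in H₁, F x ∂π₁ ≤ ∫⁻ x in H₁', F x ∂π₁ := lintegral_mono_set hsub
      _ = ∫⁻ x, H₁'.indicator F x ∂π₁ := (lintegral_indicator hH1m' F).symm
      _ = ∫⁻ x' in H₀, ∫⁻ y, F (Fin.insertNth j y x') ∂ν ∂π₀ := lintegral_indicator_hardCore_sdiff_eq j hF
      _ ≤ π₀ H₀ * ∫⁻ x', ∫⁻ y, F (Fin.insertNth j y x') ∂ν ∂(π₀[|H₀]) := by
          rcases eq_or_ne (π₀ H₀) 0 with h0 | h0
          · rw [setLIntegral_measure_zero _ _ h0]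
            exact bot_le
          · rw [ProbabilityTheory.cond, lintegral_smul_measure, smul_eq_mul, ← mul_assoc,
              ENNReal.mul_inv_cancel h0 (measure_ne_top _ _), one_mul]
  -- assemble
  rcases eq_or_ne (π₁ H₁) 0 with h0 | h0
  · have : π₁[|H₁] = 0 := by
      rw [ProbabilityTheory.cond, Measure.restrict_eq_zero.2 h0, smul_zero]
    rw [this, lintegral_zero_measure]
    exact bot_le
  · rw [ProbabilityTheory.cond, lintegral_smul_measure, smul_eq_mul]
    calc (π₁ H₁)⁻¹ * ∫⁻ x in H₁, F x ∂π₁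
        ≤ (π₁ H₁)⁻¹ * (π₀ H₀ * ∫⁻ x', ∫⁻ y, F (Fin.insertNth j y x') ∂ν ∂(π₀[|H₀])) := mul_le_mul' le_rfl hnum
      _ = ((π₁ H₁)⁻¹ * π₀ H₀) * ∫⁻ x', ∫⁻ y, F (Fin.insertNth j y x') ∂ν ∂(π₀[|H₀]) := by rw [mul_assoc]
      _ ≤ 2 * ∫⁻ x', ∫⁻ y, F (Fin.insertNth j y x') ∂ν ∂(π₀[|H₀]) := by
          refine mul_le_mul' ?_ le_rfl
          rw [hmass]
          calc (π₁ H₁)⁻¹ * π₁ H₁' ≤ (π₁ H₁)⁻¹ * (2 * π₁ H₁) := mul_le_mul' le_rfl hratio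
            _ = 2 := by rw [mul_comm 2, ← mul_assoc, ENNReal.inv_mul_cancel h0 (measure_ne_top _ _), one_mul]

/-- The uniform law on the cube is dominated by `L⁻³ ×` Lebesgue measure:
`∫ g dν ≤ L⁻³ ∫ g dy`. [folklore] -/
theorem lintegral_cond_cellCube_le_pow {L : ℝ} (hL : 0 < L) (g : V3 → ℝ≥0∞) :
    ∫⁻ y, g y ∂(volume[|cellCube L]) ≤ ENNReal.ofReal ((L ^ 3)⁻¹) * ∫⁻ y, g y := by
  rw [ProbabilityTheory.cond, lintegral_smul_measure, inv_volume_cellCube hL, smul_eq_mul]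
  exact mul_le_mul' le_rfl (lintegral_mono' Measure.restrict_le_self le_rfl)

end PosLaw

/-! ## The insertion inequality for the cell law -/

section CellLaw

/-- **Disintegration of the cell law**: `∫ F dP_{n,L} = ∫ dγ^{⊗n}(v) ∫ dposLaw(x) F(x, v)`. [folklore] -/
theorem lintegral_cellLaw_eq {σ : ℝ} (hfac : CellLawFactorises σ) (L : ℝ) (n : ℕ) (Ψ : Flows σ)
    [SFinite (posLaw σ L n)] {F : Cell n → ℝ≥0∞} (hF : Measurable F) :
    ∫⁻ z, F z ∂cellLaw σ L n Ψ =
      ∫⁻ v, ∫⁻ x, F (fun c => (x c, v c)) ∂posLaw σ L n ∂(Measure.pi fun _ : Fin n => stdGaussian V3) := by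
  set e := MeasurableEquiv.arrowProdEquivProdArrow V3 V3 (Fin n) with he
  have hpv : (fun z : Cell n => (pos z, vel z)) = ⇑e := rfl
  have h1 : ∫⁻ z, F z ∂cellLaw σ L n Ψ = ∫⁻ p, F (e.symm p) ∂((cellLaw σ L n Ψ).map e) := by
    rw [lintegral_map_equiv]
    simp only [MeasurableEquiv.symm_apply_apply]
  rw [h1, ← hpv, hfac L n Ψ, lintegral_prod_symm (f := fun p => F (e.symm p)) (hF.comp e.symm.measurable).aemeasurable]
  rfl

/-- Inserting a particle and splitting into positions and velocities commute. [folklore] -/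
theorem insertNth_prod_eq {m : ℕ} (j : Fin (m + 1)) (y w : V3) (x' v' : Fin m → V3) :
    (Fin.insertNth j (y, w) (fun c => (x' c, v' c)) : Cell (m + 1)) =
      fun c => ((Fin.insertNth j y x' : Fin (m + 1) → V3) c, (Fin.insertNth j w v' : Fin (m + 1) → V3) c) := by
  funext c
  refine Fin.succAboveCases j ?_ (fun a => ?_) c
  · simp
  · simp [Fin.insertNth_apply_succAbove]

/-- **The insertion (particle-removal) inequality for the cell law**: for `0 < σ ≤ 3/16`, `L ≥ 1`,
`m + 1 ≤ 2L³`, every label `j` and measurable `F ≥ 0`, `∫ F dP_{m+1,L} ≤ 2 ∫ dγ(w) ∫ dP_{m,L}(z') ∫ dν(y)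
F(insert_j (y, w) z')` — the other spheres are dominated by twice the `m`-sphere cell law, the removed one being
uniform on the cube with an independent Maxwellian velocity. [cite: Ruelle1969, §4.2] -/
theorem lintegral_cellLaw_succ_le {σ L : ℝ} (hσ : 0 < σ) (hσ' : σ ≤ 3 / 16) (hfac : CellLawFactorises σ)
    (hL : 1 ≤ L) {m : ℕ} (hm : ((m + 1 : ℕ) : ℝ) ≤ 2 * L ^ 3) (Ψ : Flows σ) (j : Fin (m + 1))
    {F : Cell (m + 1) → ℝ≥0∞} (hF : Measurable F) :
    ∫⁻ z, F z ∂cellLaw σ L (m + 1) Ψ ≤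
      2 * ∫⁻ w, ∫⁻ z', ∫⁻ y, F (Fin.insertNth j (y, w) z') ∂(volume[|cellCube L]) ∂cellLaw σ L m Ψ
        ∂stdGaussian V3 := by
  have hm0 : (m : ℝ) ≤ 2 * L ^ 3 := le_trans (by exact_mod_cast Nat.le_succ m) hm
  haveI := isProbabilityMeasure_posLaw (posZ_ne_zero hσ' hL hm)
  haveI := isProbabilityMeasure_posLaw (posZ_ne_zero hσ' hL hm0)
  set ν : Measure V3 := volume[|cellCube L] with hν
  set e₁ := MeasurableEquiv.arrowProdEquivProdArrow V3 V3 (Fin (m + 1)) with he₁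
  set e₀ := MeasurableEquiv.arrowProdEquivProdArrow V3 V3 (Fin m) with he₀
  -- measurability of the building blocks
  have hins : Measurable fun p : (V3 × V3) × Cell m => (Fin.insertNth j p.1 p.2 : Cell (m + 1)) :=
    (MeasurableEquiv.piFinSuccAbove (fun _ : Fin (m + 1) => V3 × V3) j).symm.measurable
  have hzip : ∀ n : ℕ, Measurable fun p : (Fin n → V3) × (Fin n → V3) => (fun c => (p.1 c, p.2 c) : Cell n) :=
    fun n => (MeasurableEquiv.arrowProdEquivProdArrow V3 V3 (Fin n)).symm.measurable
  -- Step 1: disintegrate along (pos, vel) and apply the insertion inequality for the position law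
  rw [lintegral_cellLaw_eq hfac L (m + 1) Ψ hF]
  have hstep : ∀ v : Fin (m + 1) → V3, ∫⁻ x, F (fun c => (x c, v c)) ∂posLaw σ L (m + 1) ≤
      2 * ∫⁻ x', ∫⁻ y, F (fun c => ((Fin.insertNth j y x' : Fin (m + 1) → V3) c, v c)) ∂ν ∂posLaw σ L m :=
    fun v => lintegral_posLaw_succ_le hσ hσ' hL hm0 j (F := fun x => F (fun c => (x c, v c)))
      ((hF.comp (hzip (m + 1))).comp (measurable_id.prodMk measurable_const))
  refine (lintegral_mono hstep).trans ?_
  rw [lintegral_const_mul' _ _ ENNReal.ofNat_ne_top]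
  refine mul_le_mul' le_rfl ?_
  -- Step 2: split the velocities `v = insert_j w v'`
  have hmpv := measurePreserving_piFinSuccAbove (fun _ : Fin (m + 1) => stdGaussian V3) j
  set ev := MeasurableEquiv.piFinSuccAbove (fun _ : Fin (m + 1) => V3) j with hev
  have hK : Measurable fun v : Fin (m + 1) → V3 =>
      ∫⁻ x', ∫⁻ y, F (fun c => ((Fin.insertNth j y x' : Fin (m + 1) → V3) c, v c)) ∂ν ∂posLaw σ L m := by
    refine Measurable.lintegral_prod_right' (f := fun p : (Fin (m + 1) → V3) × (Fin m → V3) =>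
      ∫⁻ y, F (fun c => ((Fin.insertNth j y p.2 : Fin (m + 1) → V3) c, p.1 c)) ∂ν) ?_
    refine Measurable.lintegral_prod_right' (f := fun q : ((Fin (m + 1) → V3) × (Fin m → V3)) × V3 =>
      F (fun c => ((Fin.insertNth j q.2 q.1.2 : Fin (m + 1) → V3) c, q.1.1 c))) ?_
    refine hF.comp ((hzip (m + 1)).comp (Measurable.prodMk ?_ (measurable_fst.comp measurable_fst)))
    exact (MeasurableEquiv.piFinSuccAbove (fun _ : Fin (m + 1) => V3) j).symm.measurable.comp
      (measurable_snd.prodMk (measurable_snd.comp measurable_fst))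
  have h2 : ∫⁻ v, ∫⁻ x', ∫⁻ y, F (fun c => ((Fin.insertNth j y x' : Fin (m + 1) → V3) c, v c)) ∂ν ∂posLaw σ L m
      ∂(Measure.pi fun _ : Fin (m + 1) => stdGaussian V3) =
      ∫⁻ p, ∫⁻ x', ∫⁻ y, F (fun c => ((Fin.insertNth j y x' : Fin (m + 1) → V3) c, ev.symm p c)) ∂ν ∂posLaw σ L m
        ∂((stdGaussian V3).prod (Measure.pi fun _ : Fin m => stdGaussian V3)) := by
    rw [← hmpv.map_eq, lintegral_map_equiv]
    simp only [hev, MeasurableEquiv.symm_apply_apply]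
  rw [h2, lintegral_prod (f := fun p : V3 × (Fin m → V3) =>
    ∫⁻ x', ∫⁻ y, F (fun c => ((Fin.insertNth j y x' : Fin (m + 1) → V3) c, ev.symm p c)) ∂ν ∂posLaw σ L m)
    ((hK.comp ev.symm.measurable).aemeasurable)]
  refine lintegral_mono fun w => ?_
  -- Step 3: reassemble `(x', v')` into the `m`-sphere cell law
  rw [lintegral_cellLaw_eq hfac L m Ψ]
  · refine le_of_eq (lintegral_congr fun v' => lintegral_congr fun x' => lintegral_congr fun y => ?_)
    rw [insertNth_prod_eq]
    rfl
  · refine Measurable.lintegral_prod_right' (f := fun q : Cell m × V3 => F (Fin.insertNth j (q.2, w) q.1)) ?_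
    exact hF.comp (hins.comp ((measurable_snd.prodMk measurable_const).prodMk measurable_fst))

/-- The cell law is absolutely continuous with respect to the Liouville measure, so almost every datum is good
for the whole-cell flow. [folklore] -/
theorem ae_mem_good_cellLaw (σ L : ℝ) (n : ℕ) (Ψ : Flows σ) : ∀ᵐ z ∂cellLaw σ L n Ψ, z ∈ (Ψ n).good := by
  have hac : cellLaw σ L n Ψ ≪ liouville (Euclidean.geometry (Fin 3)) n σ := by
    rw [cellLaw, particleLaw_eq]
    exact withDensity_absolutelyContinuous _ _
  exact hac.ae_le (Ψ n).ae_mem_good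

/-- Removing the inserted particle gives back the configuration. [folklore] -/
theorem removeNth_insertNth_cell {m : ℕ} (j : Fin (m + 1)) (p : V3 × V3) (z' : Cell m) :
    (fun c => (Fin.insertNth j p z' : Cell (m + 1)) (j.succAbove c)) = z' := by
  funext c
  simp [Fin.insertNth_apply_succAbove]

/-- **Almost every datum of the `(m+1)`-sphere cell law restricts to a good datum of the `m`-sphere flow**
(insertion inequality for the indicator of the bad set, and `ae_mem_good_cellLaw` at level `m`). [folklore] -/
theorem ae_removeNth_mem_good {σ L : ℝ} (hσ : 0 < σ) (hσ' : σ ≤ 3 / 16) (hfac : CellLawFactorises σ)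
    (hL : 1 ≤ L) {m : ℕ} (hm : ((m + 1 : ℕ) : ℝ) ≤ 2 * L ^ 3) (Ψ : Flows σ) (j : Fin (m + 1)) :
    ∀ᵐ z ∂cellLaw σ L (m + 1) Ψ, (fun c => z (j.succAbove c)) ∈ (Ψ m).good := by
  have hrm : Measurable fun z : Cell (m + 1) => (fun c => z (j.succAbove c) : Cell m) :=
    measurable_pi_lambda _ fun c => measurable_pi_apply _
  have hS : MeasurableSet {z : Cell (m + 1) | (fun c => z (j.succAbove c)) ∉ (Ψ m).good} :=
    (hrm (Ψ m).measurableSet_good).compl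
  rw [ae_iff]
  refine le_antisymm ?_ bot_le
  change cellLaw σ L (m + 1) Ψ {z : Cell (m + 1) | (fun c => z (j.succAbove c)) ∉ (Ψ m).good} ≤ 0
  rw [← lintegral_indicator_one hS]
  refine (lintegral_cellLaw_succ_le hσ hσ' hfac hL hm Ψ j (measurable_one.indicator hS)).trans ?_
  have hzero : ∀ w : V3, ∫⁻ z', ∫⁻ y, {z : Cell (m + 1) | (fun c => z (j.succAbove c)) ∉ (Ψ m).good}.indicator 1
      (Fin.insertNth j (y, w) z' : Cell (m + 1)) ∂(volume[|cellCube L]) ∂cellLaw σ L m Ψ = 0 := by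
    intro w
    refine (lintegral_eq_zero_iff' ?_).2 ?_
    · refine (Measurable.lintegral_prod_right' (f := fun q : Cell m × V3 =>
        {z : Cell (m + 1) | (fun c => z (j.succAbove c)) ∉ (Ψ m).good}.indicator 1
          (Fin.insertNth j (q.2, w) q.1 : Cell (m + 1))) ?_).aemeasurable
      exact (measurable_one.indicator hS).comp
        ((MeasurableEquiv.piFinSuccAbove (fun _ : Fin (m + 1) => V3 × V3) j).symm.measurable.comp
          ((measurable_snd.prodMk measurable_const).prodMk measurable_fst))
    · filter_upwards [ae_mem_good_cellLaw σ L m Ψ] with z' hz'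
      have hnot : ∀ y : V3, (Fin.insertNth j (y, w) z' : Cell (m + 1)) ∉
          {z : Cell (m + 1) | (fun c => z (j.succAbove c)) ∉ (Ψ m).good} := fun y h => by
        simp only [Set.mem_setOf_eq, removeNth_insertNth_cell] at h
        exact h hz'
      simp only [indicator_of_notMem (hnot _), lintegral_zero, Pi.zero_apply]
  simp only [hzero, lintegral_zero, mul_zero, le_refl]

/-- **The mean kinetic energy under the cell law**: `∫ ∑ₑ ‖vₑ‖² dP_{n,L} ≤ 3 n` (Maxwellian velocities). [folklore] -/
theorem lintegral_kinetic_cellLaw_le {σ : ℝ} (hfac : CellLawFactorises σ) (L : ℝ) (n : ℕ) (Ψ : Flows σ)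
    [IsFiniteMeasure (posLaw σ L n)] (hle : posLaw σ L n Set.univ ≤ 1) :
    ∫⁻ z, ∑ e, ENNReal.ofReal (‖(z e).2‖ ^ 2) ∂cellLaw σ L n Ψ ≤ 3 * n := by
  have hmeas : Measurable fun z : Cell n => ∑ e, ENNReal.ofReal (‖(z e).2‖ ^ 2) :=
    Finset.measurable_sum _ fun e _ => ((measurable_pi_apply e).snd.norm.pow_const 2).ennreal_ofReal
  rw [lintegral_cellLaw_eq hfac L n Ψ hmeas]
  simp only [lintegral_const]
  calc ∫⁻ v, (∑ e, ENNReal.ofReal (‖v e‖ ^ 2)) * posLaw σ L n Set.univ ∂(Measure.pi fun _ : Fin n => stdGaussian V3)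
      ≤ ∫⁻ v, ∑ e, ENNReal.ofReal (‖v e‖ ^ 2) ∂(Measure.pi fun _ : Fin n => stdGaussian V3) :=
        lintegral_mono fun v => mul_le_of_le_one_right' hle
    _ = ∑ e : Fin n, ∫⁻ v, ENNReal.ofReal (‖v e‖ ^ 2) ∂(Measure.pi fun _ : Fin n => stdGaussian V3) :=
        lintegral_finsetSum _ fun e _ => ((measurable_pi_apply e).norm.pow_const 2).ennreal_ofReal
    _ = ∑ _e : Fin n, (3 : ℝ≥0∞) := by
        refine Finset.sum_congr rfl fun e _ => ?_
        have hmp := measurePreserving_eval (fun _ : Fin n => stdGaussian V3) e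
        have hg : Measurable fun w : V3 => ENNReal.ofReal (‖w‖ ^ 2) := (measurable_norm.pow_const 2).ennreal_ofReal
        have h3 : ∫⁻ v, ENNReal.ofReal (‖v e‖ ^ 2) ∂(Measure.pi fun _ : Fin n => stdGaussian V3) =
            ∫⁻ w, ENNReal.ofReal (‖w‖ ^ 2) ∂stdGaussian V3 := MeasurePreserving.lintegral_comp hmp hg
        rw [h3, ← ofReal_integral_eq_lintegral_ofReal integrable_norm_sq_stdGaussian
          (Eventually.of_forall fun w => sq_nonneg _), integral_norm_sq_stdGaussian]
        simp
    _ = 3 * n := by rw [Finset.sum_const, Finset.card_univ, Fintype.card_fin, nsmul_eq_mul, mul_comm]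

end CellLaw

/-! ## The registered sub-goal -/

/-- **Registered sub-goal `stub_clusterTail_insertion`** (piece of stub `stub_clusterTail`, S2e, of the line
`enskog-compensator-martingale`): **the insertion (particle-removal) inequality for the canonical cell law.** For
`0 < σ ≤ 3/16`, `L ≥ 1`, `m + 1 ≤ 2L³`, every cluster dynamics, every label `j` and every measurable `F ≥ 0`,
`∫ F dP_{m+1,L} ≤ 2 ∫ dγ(w) ∫ dP_{m,L}(z') ∫ dν(y) F(insert_j (y, w) z')` with `ν` the uniform law on `[0,L]³` and
`γ` the standard Maxwellian: the environment of a tagged sphere is dominated by twice the cell law with one sphere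
less. [cite: Ruelle1969, §4.2] -/
theorem stub_clusterTail_insertion : ∀ (σ L : ℝ), 0 < σ → σ ≤ 3 / 16 → CellLawFactorises σ → 1 ≤ L →
    ∀ (m : ℕ), ((m + 1 : ℕ) : ℝ) ≤ 2 * L ^ 3 → ∀ (Ψ : Flows σ) (j : Fin (m + 1)) (F : Cell (m + 1) → ENNReal),
      Measurable F →
        ∫⁻ z, F z ∂(cellLaw σ L (m + 1) Ψ) ≤
          2 * ∫⁻ w, ∫⁻ z', ∫⁻ y, F (Fin.insertNth j (y, w) z')
            ∂(ProbabilityTheory.cond volume {y : V3 | ∀ k, y k ∈ Set.Icc (0 : ℝ) L}) ∂(cellLaw σ L m Ψ)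
            ∂(stdGaussian V3) :=
  fun _ _ hσ hσ' hfac hL _ hm Ψ j _ hF => lintegral_cellLaw_succ_le hσ hσ' hfac hL hm Ψ j hF

end Summit.AtomisticToContinuum.HydrodynamicLimit.Theorems.EnskogCompensator

end
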